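import Summits.Ventures.Crystal3D.Theorems.StickyWulffConstantPolycrystalWulffBoundGapSlabPrelim
import Summits.Ventures.Crystal3D.Theorems.StickyWulffConstantPolycrystalWulffBoundTwinTreeWeights

/-!
# `PolycrystalWulffBound`, line `PolyDensity`: gap-feasible thresholds for a TREE of cells inside one
# body piece class (the in-slab step of the slab-forest construction; crux `stmt-Ventures-19482`)

Route `StickyWulffConstant` of the venture `Summits/Ventures/Crystal3D`, second prover lane (poly-p2,
gen 14).  Abstract form of the target bookkeeping of `gapTree_chimera_lower`, with the Wulff bodies
replaced by arbitrary compact PIECES `K_q` of a common volume `32·S` (think `K_q = W(A_q) ∩ {slab}`):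
given a tree `par` on `Fin (M+1)`, unit edge normals `ν c`, gaps `θ c ≥ 0` with the shift hypothesis
`|K_{par c} ∩ {s + θ c < ⟪y, ν c⟫}| ≤ |K_{c.succ} ∩ {s < ⟪y, ν c⟫}|`, and weights `σ_q ≥ 0` summing to `S`,
there are thresholds `s c` such that every
`K_q ∩ ⋂_{children c} {⟪y, ν c⟫ ≤ s c + θ c} ∩ ⋂_{q = c.succ} {s c < ⟪y, ν c⟫}` has volume `≥ 32·σ_q`
(`slabTree_targets`).  Used slab by slab by the slab-forest rung (memo P-GAP-g14 §6.7).
WHAT THIS IS NOT: a rung; the crux is not claimed.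
-/

noncomputable section

open scoped BigOperators InnerProductSpace ENNReal Pointwise
open MeasureTheory Set

namespace Summit.Ventures.Crystal3D.Theorems

open Summit.Ventures.Crystal3D.Cruxes.TextureLiminf.TexShadow (E3)

/-- **Gap-feasible thresholds for a tree of pieces of equal volume `32 S`.** -/
theorem slabTree_targets {M : ℕ} (par : Fin M → Fin (M + 1)) (hpar : ∀ c, (par c : ℕ) ≤ c)
    (K : Fin (M + 1) → Set E3) (hKc : ∀ q, IsCompact (K q)) {R : ℝ} (hR : 0 ≤ R)
    (hKR : ∀ q, K q ⊆ Metric.closedBall 0 R) {S : ℝ} (hS0 : 0 ≤ S)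
    (hKvol : ∀ q, volume (K q) = ENNReal.ofReal (32 * S))
    (ν : Fin M → E3) (hν : ∀ c, ‖ν c‖ = 1) (θ : Fin M → ℝ)
    (hshift : ∀ c (s : ℝ), volume (K (par c) ∩ {y : E3 | s + θ c < ⟪y, ν c⟫_ℝ}) ≤
      volume (K c.succ ∩ {y : E3 | s < ⟪y, ν c⟫_ℝ}))
    (σ : Fin (M + 1) → ℝ) (hσ0 : ∀ q, 0 ≤ σ q) (hσS : ∑ q, σ q = S) :
    ∃ s : Fin M → ℝ, ∀ q, ENNReal.ofReal (32 * σ q) ≤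
      volume (K q ∩ ((⋂ c ∈ Finset.univ.filter (fun c => par c = q), {y : E3 | ⟪y, ν c⟫_ℝ ≤ s c + θ c}) ∩
        ⋂ c ∈ Finset.univ.filter (fun c : Fin M => q = c.succ), {y : E3 | s c < ⟪y, ν c⟫_ℝ})) := by
  classical
  by_cases hS : S = 0
  · -- all weights vanish
    have hσz : ∀ q, σ q = 0 := by
      intro q
      have h := Finset.sum_eq_zero_iff_of_nonneg (fun q _ => hσ0 q) |>.1 (by rw [hσS, hS]) q (Finset.mem_univ q)
      exact h
    refine ⟨fun _ => 0, fun q => ?_⟩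
    rw [hσz q, mul_zero, ENNReal.ofReal_zero]
    exact bot_le
  have hSpos : 0 < S := lt_of_le_of_ne hS0 (Ne.symm hS)
  have hKm : ∀ q, MeasurableSet (K q) := fun q => (hKc q).isClosed.measurableSet
  -- normalised weights and subtree weights
  set σ' : Fin (M + 1) → ℝ := fun q => σ q / S with hσ'
  have hσ'0 : ∀ q, 0 ≤ σ' q := fun q => div_nonneg (hσ0 q) hS0
  have hσ'1 : ∑ q, σ' q = 1 := by
    simp only [hσ']
    rw [← Finset.sum_div, hσS, div_self hS]
  obtain ⟨u, hrec, hu0, hu1, hroot⟩ := exists_subtreeWeights par hpar σ' hσ'0 hσ'1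
  -- exact conditional quantiles of the children IN THEIR OWN PIECES
  have hs : ∀ c, ∃ s : ℝ, |s| ≤ R + 1 ∧
      volume (K c.succ ∩ {y : E3 | s < ⟪y, ν c⟫_ℝ}) = ENNReal.ofReal (32 * S * u c.succ) :=
    fun c => exists_capHeight_eq_of_isCompact (ν c) (hν c) (K c.succ) (hKc _) hR (hKR _)
      (by positivity) (hKvol _) (hu0 _) (hu1 _)
  choose s hsR hsC using hs
  have hsP : ∀ c, volume (K (par c) ∩ {y : E3 | s c + θ c < ⟪y, ν c⟫_ℝ}) ≤
      ENNReal.ofReal (32 * S * u c.succ) := by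
    intro c
    rw [← hsC c]
    exact hshift c (s c)
  refine ⟨s, fun q => ?_⟩
  have hgt_m : ∀ c (a : ℝ), MeasurableSet {y : E3 | a < ⟪y, ν c⟫_ℝ} := fun c a =>
    measurableSet_lt measurable_const (measurable_id.inner measurable_const)
  have hle_m : ∀ c (a : ℝ), MeasurableSet {y : E3 | ⟪y, ν c⟫_ℝ ≤ a} := fun c a =>
    measurableSet_le (measurable_id.inner measurable_const) measurable_const
  have hmemC : ∀ (y : E3), y ∈ (⋂ c ∈ Finset.univ.filter (fun c => par c = q),
      {y : E3 | ⟪y, ν c⟫_ℝ ≤ s c + θ c}) ↔ ∀ c, par c = q → ⟪y, ν c⟫_ℝ ≤ s c + θ c := by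
    intro y
    simp only [mem_iInter, Finset.mem_filter, Finset.mem_univ, true_and, mem_setOf_eq]
  have hmemO : ∀ (y : E3), y ∈ (⋂ c ∈ Finset.univ.filter (fun c : Fin M => q = c.succ),
      {y : E3 | s c < ⟪y, ν c⟫_ℝ}) ↔ ∀ c : Fin M, q = c.succ → s c < ⟪y, ν c⟫_ℝ := by
    intro y
    simp only [mem_iInter, Finset.mem_filter, Finset.mem_univ, true_and, mem_setOf_eq]
  -- own window (volume `32 S u q`) minus the children's shifted caps
  set T : Set E3 := K q ∩ ((⋂ c ∈ Finset.univ.filter (fun c => par c = q),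
      {y : E3 | ⟪y, ν c⟫_ℝ ≤ s c + θ c}) ∩
    ⋂ c ∈ Finset.univ.filter (fun c : Fin M => q = c.succ), {y : E3 | s c < ⟪y, ν c⟫_ℝ}) with hT
  set Own : Set E3 := K q ∩ ⋂ c ∈ Finset.univ.filter (fun c : Fin M => q = c.succ),
    {y : E3 | s c < ⟪y, ν c⟫_ℝ} with hOwn
  have hOwnvol : volume Own = ENNReal.ofReal (32 * S * u q) := by
    induction q using Fin.cases with
    | zero =>
      have : Own = K 0 := by
        rw [hOwn]
        refine inter_eq_left.2 fun y _ => (hmemO y).2 fun c hc => absurd hc (Fin.succ_ne_zero c).symm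
      rw [this, hKvol, hroot, mul_one]
    | succ c₀ =>
      have : Own = K c₀.succ ∩ {y : E3 | s c₀ < ⟪y, ν c₀⟫_ℝ} := by
        rw [hOwn]
        ext y
        simp only [mem_inter_iff, hmemO]
        constructor
        · rintro ⟨hy, h⟩; exact ⟨hy, h c₀ rfl⟩
        · rintro ⟨hy, h⟩
          refine ⟨hy, fun c hc => ?_⟩
          have hcc : c₀ = c := Fin.succ_inj.1 hc
          subst hcc
          exact h
      rw [this, hsC c₀]
  have hcov : Own ⊆ T ∪ ⋃ c ∈ Finset.univ.filter (fun c => par c = q),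
      (K q ∩ {y : E3 | s c + θ c < ⟪y, ν c⟫_ℝ}) := by
    rintro y ⟨hy, hyo⟩
    by_cases h : ∀ c, par c = q → ⟪y, ν c⟫_ℝ ≤ s c + θ c
    · exact Or.inl ⟨hy, (hmemC y).2 h, hyo⟩
    · simp only [not_forall, not_le] at h
      obtain ⟨c, hc, hlt⟩ := h
      exact Or.inr (mem_iUnion₂.2 ⟨c, Finset.mem_filter.2 ⟨Finset.mem_univ _, hc⟩, hy, hlt⟩)
  have hchildvol : ∀ c ∈ Finset.univ.filter (fun c => par c = q),
      volume (K q ∩ {y : E3 | s c + θ c < ⟪y, ν c⟫_ℝ}) ≤ ENNReal.ofReal (32 * S * u c.succ) := by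
    intro c hc
    rw [Finset.mem_filter] at hc
    have h := hsP c
    rw [hc.2] at h
    exact h
  have h1 : ENNReal.ofReal (32 * S * u q) ≤ volume T +
      ∑ c ∈ Finset.univ.filter (fun c => par c = q), ENNReal.ofReal (32 * S * u c.succ) := by
    rw [← hOwnvol]
    exact (measure_mono hcov).trans ((measure_union_le _ _).trans
      (add_le_add le_rfl ((measure_biUnion_finset_le _ _).trans (Finset.sum_le_sum hchildvol))))
  have h32S : 0 ≤ 32 * S := by positivity
  rw [hrec q, mul_add, Finset.mul_sum, ENNReal.ofReal_add (mul_nonneg h32S (hσ'0 q))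
    (Finset.sum_nonneg fun c _ => mul_nonneg h32S (hu0 _)),
    ENNReal.ofReal_sum_of_nonneg (fun c _ => mul_nonneg h32S (hu0 _))] at h1
  have h2 := (ENNReal.add_le_add_iff_right (ENNReal.sum_ne_top.2 fun c _ => ENNReal.ofReal_ne_top)).1 h1
  have h3 : 32 * S * σ' q = 32 * σ q := by
    rw [hσ']; field_simp
  rw [h3] at h2
  exact h2

end Summit.Ventures.Crystal3D.Theorems

end
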